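import Literature.LinearAlgebra.RootSystem.WeylGroupReflectionLength
import Literature.LinearAlgebra.RootSystem.WeylGroupInvolutions
import HarnessLib

/-!
# Length additivity for a product of two involutions with independent `(-1)`-eigenspaces
# (Carter 1972 §3, Lemmas 6 and 7); the reflections of `W` are the `s_α` (Humphreys 1990 §1.14)

R. W. Carter, *Conjugacy classes in the Weyl group*, Compositio Math. **25** (1972) 1–59 (held text `paper:doi-10-1007-bfb0081548`, pp. 5–6 of
the paper), §3 "The subset `W_0`": "If `w_i` is an involution in `W`, the decomposition of `V` with respect to `w_i` will now be denoted by
`V = V_1(w_i) ⊕ V_{-1}(w_i)` where `w_i = 1` on `V_1(w_i)` and `w_i = -1` on `V_{-1}(w_i)`. We denote by `W_0` the subset of `W` of elements `w`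
expressible in the form `w = w_1 w_2`, where `w_1² = w_2² = 1` and `V_{-1}(w_1) ∩ V_{-1}(w_2) = 0`. (It will turn out eventually that `W_0 = W`.)
LEMMA 6. Let `w = w_1 w_2` where `w_1² = w_2² = 1` and `V_{-1}(w_1) ∩ V_{-1}(w_2) = 0`. Then `V_1(w) = V_1(w_1) ∩ V_1(w_2)` and
`l̄(w) = l̄(w_1) + l̄(w_2)`. PROOF. Suppose `x` is a vector in `V` such that `w(x) = x`. Then `w_1 w_2(x) = x` and so `w_1(x) = w_2(x)`. Thus
`w_1(x) - x = w_2(x) - x`. Now `w_1(x) - x ∈ V_{-1}(w_1)` and `w_2(x) - x ∈ V_{-1}(w_2)`. Thus both these vectors are `0` … we have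
`l̄(w) = l - dim V_1(w) = 2l - dim V_1(w_1) - dim V_1(w_2) = l̄(w_1) + l̄(w_2)`. LEMMA 7. `W_0` is a union of conjugacy classes of `W`."

THIS FILE (lane `lit-hodgefound`, prover seat p40, generation 38, row g38-#5; topic `Literature/LinearAlgebra/RootSystem`, namespace
`Literature.LinearAlgebra.RootSystem(.Base)`) proves Lemma 6 and Lemma 7 for Mathlib's Weyl group `P.weylGroup ≤ Aut P` of a finite reduced
crystallographic root pairing `P : RootPairing ι K M N` over a field `K` of characteristic `0` (NO order, NO Euclidean structure), acting on a
finite-dimensional weight space `M`; `V_1(w)`, `V_{-1}(w)` are Mathlib's `Module.End.eigenspace (w|_V) 1`, `… (-1)`, and `l̄(w)` is, as in the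
sibling file `WeylGroupReflectionLength` (g38-#4, Carter's Lemma 2), the number `dim (w - 1)V`. `W_0` is NOT introduced as a definition: Lemma 7 is
stated as "the defining property of `W_0` passes to conjugates".

PROOF ROUTE. The first assertion of Lemma 6 is Carter's, verbatim (§2). For the second, Carter's dimension count `dim V_1(w_1) + dim V_1(w_2) =
l + dim (V_1(w_1) ∩ V_1(w_2))` uses orthogonal complements; here instead (§4): write `w_i = w_{r_1} ⋯ w_{r_{k_i}}` with mutually orthogonal roots
(Carter's Lemma 5, tree `WeylGroupInvolutions`, g38-#1), so that `V_{-1}(w_i) = span{r's of w_i}`; the hypothesis `V_{-1}(w_1) ∩ V_{-1}(w_2) = 0`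
makes the concatenated family of `k_1 + k_2` roots linearly independent, hence (Carter's Lemma 3 ⟸, tree `WeylGroupReflectionLength`, g38-#4) the
concatenated word for `w = w_1 w_2` is reduced: `dim (w - 1)V = k_1 + k_2 = dim (w_1 - 1)V + dim (w_2 - 1)V`.

## What is proved (THEOREMS ONLY: no definition, no instance, no notation, no named fact; net debt 0)

* §1 **`ker_sub_id_eq_eigenspace_one`** (`V^w = V_1(w)`), **`range_sub_id_le_eigenspace_neg_one_of_mul_self_eq_one`** ∕ ★
  **`range_sub_id_eq_eigenspace_neg_one_of_mul_self_eq_one`** (for an involution, `(w - 1)V = V_{-1}(w)`: Carter's two readings of `l̄(w)` —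
  `dim (w - 1)V` of Lemma 2 and `dim V_{-1}(w)` of Lemma 5 — agree).
* §2 ★★ **`ker_sub_id_mul_eq_inf_of_mul_self_eq_one`** (LEMMA 6, FIRST ASSERTION: `V_1(w_1 w_2) = V_1(w_1) ∩ V_1(w_2)`; any two involutions of
  `Aut P` with `V_{-1}(w_1) ∩ V_{-1}(w_2) = 0`).
* §3 **`linearIndependent_root_getElem_iff`** ∕ **`linearIndependent_root_getElem_of_linearIndepOn`** (the two readings of "`r_1, …, r_k` linearly
  independent": as a `Fin k`-family, or distinct indices with `LinearIndepOn`), ★★ **`Base.finrank_range_sub_id_eq_length_iff_nodup_and_linearIndepOn`**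
  (Carter's LEMMA 3 of g38-#4 in the second reading).
* §4 ★★★ **`Base.finrank_range_sub_id_mul_eq_add_of_mul_self_eq_one`** (LEMMA 6, SECOND ASSERTION: `l̄(w_1 w_2) = l̄(w_1) + l̄(w_2)` for involutions
  `w_1, w_2 ∈ W` with `V_{-1}(w_1) ∩ V_{-1}(w_2) = 0`), ★★ **`Base.finrank_ker_sub_id_mul_of_mul_self_eq_one`** (Carter's form
  `dim V_1(w) = dim V_1(w_1) + dim V_1(w_2) - l`), ★ **`Base.finrank_range_sub_id_mul_eq_add_finrank_eigenspace`** (`l̄(w_1 w_2) = dim V_{-1}(w_1) +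
  dim V_{-1}(w_2)`), **`range_sub_id_mul_le_sup`** (`(w_1 w_2 - 1)V ⊆ (w_1 - 1)V + (w_2 - 1)V`, any `w_1, w_2`), ★★
  **`Base.range_sub_id_mul_eq_sup_of_mul_self_eq_one`** (`(w_1 w_2 - 1)V = V_{-1}(w_1) ⊕ V_{-1}(w_2)` under Lemma 6's hypotheses).
* §5 **`range_sub_id_conj_eq_map`** ∕ ★ **`finrank_range_sub_id_conj`** (`(gwg⁻¹ - 1)V = g (w - 1)V`, so `l̄` is a class function),
  **`eigenspace_conj_eq_map`** (`V_μ(gwg⁻¹) = g V_μ(w)`), ★★ **`exists_conj_eq_mul_of_eq_mul`** (LEMMA 7: the `W_0`-property passes to `W`-conjugates).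
* §6 **`Base.finrank_range_reflection_sub_id`** (`dim (s_α - 1)V = 1`), ★★★ **`Base.exists_eq_reflection_of_finrank_range_sub_id_eq_one`** (HUMPHREYS
  1990 §1.14 PROPOSITION IN GEOMETRIC FORM: an element of `W` acting on `V` as a reflection — `dim (w - 1)V = 1` — is some `s_α`; closes the scope
  caveat of `WeylGroupReflections` «the statement that an element of `W` acting on `V` as a LINEAR reflection is some `s_α` is not treated»), ★★
  **`Base.exists_eq_reflection_iff_finrank_range_sub_id_eq_one`**, ★★ **`Base.exists_eq_reflection_of_finrank_ker_sub_id_add_one_eq`** (hyperplane form).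

BY NAME, nothing restated: g38-#1 `Base.exists_pairwise_isOrthogonal_prod_eq_of_mul_self_eq_one` (Carter Lemma 5), `eigenspace_neg_one_eq_span_of_prod_eq`,
`linearIndepOn_root_of_pairwise_isOrthogonal`, `nodup_of_pairwise_isOrthogonal`, `smul_smul_eq_self_of_mul_self_eq_one` (`WeylGroupInvolutions`); g38-#4
`Base.finrank_range_sub_id_eq_length_of_linearIndependent` ∕ `Base.finrank_range_sub_id_eq_length_iff_linearIndependent` (Carter Lemma 3),
`toLinearMap_sub_id_apply`, `mem_ker_sub_id_iff`, `finrank_range_add_finrank_ker` (`WeylGroupReflectionLength`); Mathlib `LinearIndepOn.union`,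
`List.nodup_append`, `List.Nodup.getElem_inj_iff`, `Submodule.map_inf`, `Submodule.equivMapOfInjective`, `Submodule.eq_of_le_of_finrank_le`,
`Submodule.finrank_add_le_finrank_add_finrank`.

## Scope caveats

`W_0` and the Carter graph `Γ` of §3 are not defined here (definitions go through the review path); "`W_0 = W`" (Carter's Theorem C) is not
touched. In Lemma 6 the involutions are taken in `W` (as in Carter's `W_0`), although §2 holds for any two involutions of `Aut P`. `M` is
finite-dimensional in §4.

## References

* [Carter1972WeylConjugacy] R. W. Carter, *Conjugacy classes in the Weyl group*, Compositio Math. 25 (1972) 1–59 — §3, Lemmas 6–7 (and §2, Lemmas 2, 3, 5).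
* [Humphreys1990] J. E. Humphreys, *Reflection Groups and Coxeter Groups*, CUP (1990) — §1.14 Proposition, p. 24.
-/

noncomputable section

open Module Set Function
open Submodule (span)

namespace Literature.LinearAlgebra.RootSystem

variable {ι K M N : Type*} [Field K] [CharZero K] [AddCommGroup M] [Module K M]
  [AddCommGroup N] [Module K N] [Fintype ι]
  {P : RootPairing ι K M N} [P.IsCrystallographic] [P.IsReduced]

/-! ## §1 For an involution, `V^w = V_1(w)` and `(w - 1)V = V_{-1}(w)` -/

section Involution

omit [CharZero K] [Fintype ι] [P.IsCrystallographic] [P.IsReduced] in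
/-- `V^w = ker (w - 1)` is the `1`-eigenspace `V_1(w)`. [cite: Carter1972WeylConjugacy, §3 ("w_i = 1 on V_1(w_i)")] -/
theorem ker_sub_id_eq_eigenspace_one (w : P.Aut) :
    LinearMap.ker (DistribSMul.toLinearMap K M w - 1) = Module.End.eigenspace (DistribSMul.toLinearMap K M w) 1 := by
  ext x
  rw [mem_ker_sub_id_iff, Module.End.mem_eigenspace_iff, DistribSMul.toLinearMap_apply, one_smul]

omit [CharZero K] [Fintype ι] [P.IsCrystallographic] [P.IsReduced] in
/-- For an involution `w`, `(w - 1)V ⊆ V_{-1}(w)`: `w(wx - x) = x - wx`. [cite: Carter1972WeylConjugacy, §3 Lemma 6 (proof: "w_1(x) - x ∈ V_{-1}(w_1)")] -/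
theorem range_sub_id_le_eigenspace_neg_one_of_mul_self_eq_one {w : P.Aut} (h2 : w * w = 1) :
    LinearMap.range (DistribSMul.toLinearMap K M w - 1) ≤ Module.End.eigenspace (DistribSMul.toLinearMap K M w) (-1) := by
  rintro _ ⟨x, rfl⟩
  rw [Module.End.mem_eigenspace_iff, DistribSMul.toLinearMap_apply, toLinearMap_sub_id_apply (P := P), smul_sub,
    smul_smul_eq_self_of_mul_self_eq_one h2, neg_one_smul, neg_sub]

omit [Fintype ι] [P.IsCrystallographic] [P.IsReduced] in
/-- ★ **For an involution `w`, `(w - 1)V = V_{-1}(w)`** (characteristic `≠ 2`: `x = (w - 1)(-x/2)` when `wx = -x`) — so Carter's two readings of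
`l̄(w)`, `dim (w - 1)V` (Lemma 2) and `dim V_{-1}(w)` (Lemma 5), agree. [cite: Carter1972WeylConjugacy, §2 Lemma 5 and §3 Lemma 6 (proof)] -/
theorem range_sub_id_eq_eigenspace_neg_one_of_mul_self_eq_one {w : P.Aut} (h2 : w * w = 1) :
    LinearMap.range (DistribSMul.toLinearMap K M w - 1) = Module.End.eigenspace (DistribSMul.toLinearMap K M w) (-1) := by
  refine le_antisymm (range_sub_id_le_eigenspace_neg_one_of_mul_self_eq_one h2) fun x hx ↦ ?_
  rw [Module.End.mem_eigenspace_iff, DistribSMul.toLinearMap_apply, neg_one_smul] at hx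
  refine ⟨-((2 : K)⁻¹ • x), ?_⟩
  rw [toLinearMap_sub_id_apply (P := P), smul_neg, smul_comm w ((2 : K)⁻¹) x, hx, smul_neg, neg_neg, sub_neg_eq_add, ← two_smul K,
    smul_smul, mul_inv_cancel₀ two_ne_zero, one_smul]

end Involution

/-! ## §2 Lemma 6, first assertion: `V_1(w_1 w_2) = V_1(w_1) ∩ V_1(w_2)` -/

section FixedSpace

omit [CharZero K] [Fintype ι] [P.IsCrystallographic] [P.IsReduced] in
/-- ★★ **CARTER 1972 §3 LEMMA 6, FIRST ASSERTION: `V_1(w_1 w_2) = V_1(w_1) ∩ V_1(w_2)`** for involutions `w_1, w_2` with `V_{-1}(w_1) ∩ V_{-1}(w_2) = 0`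
(«Suppose `w(x) = x`. Then `w_1 w_2(x) = x` and so `w_1(x) = w_2(x)`. Thus `w_1(x) - x = w_2(x) - x`. Now `w_1(x) - x ∈ V_{-1}(w_1)` and
`w_2(x) - x ∈ V_{-1}(w_2)`. Thus both these vectors are `0`»; here for any two involutions of `Aut P`, fixed spaces written `ker (w - 1)`).
[cite: Carter1972WeylConjugacy, §3 Lemma 6 ("Then V_1(w) = V_1(w_1) ∩ V_1(w_2)")] -/
theorem ker_sub_id_mul_eq_inf_of_mul_self_eq_one {w₁ w₂ : P.Aut} (h₁ : w₁ * w₁ = 1) (h₂ : w₂ * w₂ = 1)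
    (h : Module.End.eigenspace (DistribSMul.toLinearMap K M w₁) (-1) ⊓ Module.End.eigenspace (DistribSMul.toLinearMap K M w₂) (-1) = ⊥) :
    LinearMap.ker (DistribSMul.toLinearMap K M (w₁ * w₂) - 1) =
      LinearMap.ker (DistribSMul.toLinearMap K M w₁ - 1) ⊓ LinearMap.ker (DistribSMul.toLinearMap K M w₂ - 1) := by
  refine le_antisymm (fun x hx ↦ ?_) fun x hx ↦ ?_
  · rw [mem_ker_sub_id_iff, mul_smul] at hx
    -- `w₁ x = w₂ x`
    have h3 : w₁ • x = w₂ • x := by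
      have h4 := congr_arg (w₁ • ·) hx
      simp only [smul_smul_eq_self_of_mul_self_eq_one h₁] at h4
      exact h4.symm
    -- `w₁ x - x = w₂ x - x` lies in `V_{-1}(w₁) ∩ V_{-1}(w₂) = 0`
    have e₁ : w₁ • x - x ∈ LinearMap.range (DistribSMul.toLinearMap K M w₁ - 1) := ⟨x, rfl⟩
    have e₂ : w₂ • x - x ∈ LinearMap.range (DistribSMul.toLinearMap K M w₂ - 1) := ⟨x, rfl⟩
    have hd : w₁ • x - x ∈ Module.End.eigenspace (DistribSMul.toLinearMap K M w₁) (-1) ⊓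
        Module.End.eigenspace (DistribSMul.toLinearMap K M w₂) (-1) := by
      refine Submodule.mem_inf.mpr ⟨range_sub_id_le_eigenspace_neg_one_of_mul_self_eq_one h₁ e₁, ?_⟩
      rw [h3]
      exact range_sub_id_le_eigenspace_neg_one_of_mul_self_eq_one h₂ e₂
    rw [h, Submodule.mem_bot, sub_eq_zero] at hd
    refine Submodule.mem_inf.mpr ⟨(mem_ker_sub_id_iff w₁ x).mpr hd, (mem_ker_sub_id_iff w₂ x).mpr ?_⟩
    rw [← h3, hd]
  · obtain ⟨hx₁, hx₂⟩ := Submodule.mem_inf.mp hx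
    rw [mem_ker_sub_id_iff] at hx₁ hx₂ ⊢
    rw [mul_smul, hx₂, hx₁]

end FixedSpace

/-! ## §3 The two readings of "`r_1, …, r_k` linearly independent" -/

section Readings

omit [CharZero K] [Fintype ι] [P.IsCrystallographic] [P.IsReduced] in
/-- Distinct indices with linearly independent roots give a linearly independent `Fin k`-family `j ↦ r_{i_j}`.
[cite: Carter1972WeylConjugacy, §2 Lemma 3 ("r_1, r_2 ⋯ r_k are linearly independent")] -/
theorem linearIndependent_root_getElem_of_linearIndepOn (l : List ι) (hnd : l.Nodup) (h : LinearIndepOn K P.root {i | i ∈ l}) :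
    LinearIndependent K (fun j : Fin l.length ↦ P.root l[j]) :=
  h.comp (fun j : Fin l.length ↦ (⟨l[j], List.getElem_mem j.2⟩ : {i // i ∈ l})) fun j j' hjj' ↦
    Fin.ext (hnd.getElem_inj_iff.mp (congrArg Subtype.val hjj'))

omit [CharZero K] [Fintype ι] [P.IsCrystallographic] [P.IsReduced] in
/-- **The `Fin k`-family `j ↦ r_{i_j}` is linearly independent iff the indices are distinct and the set of roots `{r_i}` is linearly independent.**
[cite: Carter1972WeylConjugacy, §2 Lemma 3 ("r_1, r_2 ⋯ r_k are linearly independent")] -/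
theorem linearIndependent_root_getElem_iff (l : List ι) :
    LinearIndependent K (fun j : Fin l.length ↦ P.root l[j]) ↔ l.Nodup ∧ LinearIndepOn K P.root {i | i ∈ l} := by
  refine ⟨fun h ↦ ?_, fun h ↦ linearIndependent_root_getElem_of_linearIndepOn l h.1 h.2⟩
  refine ⟨List.nodup_iff_injective_get.mpr (Function.Injective.of_comp (f := P.root) h.injective), ?_⟩
  have h1 : LinearIndepOn K (P.root ∘ l.get) Set.univ := (linearIndepOn_univ_iff (R := K) (v := P.root ∘ l.get)).mpr h
  have h2 := h1.image_of_comp l.get P.root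
  rwa [Set.image_univ, Set.range_list_get] at h2

namespace Base

variable (b : P.Base)

include b in
/-- ★★ **CARTER 1972 §2 LEMMA 3, second reading: `w_{r_1} ⋯ w_{r_k}` is reduced iff the indices are distinct and `{r_1, …, r_k}` is a linearly
independent set.** [cite: Carter1972WeylConjugacy, §2 Lemma 3 ("w_{r_1} w_{r_2} ⋯ w_{r_k} is reduced if and only if r_1, r_2 ⋯ r_k are linearly independent")] -/
theorem finrank_range_sub_id_eq_length_iff_nodup_and_linearIndepOn [Module.Finite K M] (l : List ι) :
    Module.finrank K (LinearMap.range (DistribSMul.toLinearMap K M (l.map (RootPairing.Equiv.reflection P)).prod - 1)) = l.length ↔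
      l.Nodup ∧ LinearIndepOn K P.root {i | i ∈ l} := by
  rw [finrank_range_sub_id_eq_length_iff_linearIndependent b l, linearIndependent_root_getElem_iff]

end Base

end Readings

/-! ## §4 Lemma 6, second assertion: `l̄(w_1 w_2) = l̄(w_1) + l̄(w_2)` -/

section Length

namespace Base

variable (b : P.Base)

include b in
/-- ★★★ **CARTER 1972 §3 LEMMA 6, SECOND ASSERTION: `l̄(w_1 w_2) = l̄(w_1) + l̄(w_2)`** — for involutions `w_1, w_2 ∈ W` with
`V_{-1}(w_1) ∩ V_{-1}(w_2) = 0`, `dim (w_1 w_2 - 1)V = dim (w_1 - 1)V + dim (w_2 - 1)V` (`l̄ = dim (w - 1)V` by Carter's Lemma 2, tree g38-#4).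
Route: orthogonal decompositions `w_i = w_{r_1} ⋯ w_{r_{k_i}}` (Carter's Lemma 5, tree), `V_{-1}(w_i) = span{r's}`, so the `k_1 + k_2` roots
together are linearly independent and the concatenated word for `w_1 w_2` is reduced (Carter's Lemma 3, tree).
[cite: Carter1972WeylConjugacy, §3 Lemma 6 ("l̄(w) = l̄(w_1) + l̄(w_2)")] -/
theorem finrank_range_sub_id_mul_eq_add_of_mul_self_eq_one [Module.Finite K M] {w₁ w₂ : P.Aut} (hw₁ : w₁ ∈ P.weylGroup)
    (hw₂ : w₂ ∈ P.weylGroup) (h₁ : w₁ * w₁ = 1) (h₂ : w₂ * w₂ = 1)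
    (h : Module.End.eigenspace (DistribSMul.toLinearMap K M w₁) (-1) ⊓ Module.End.eigenspace (DistribSMul.toLinearMap K M w₂) (-1) = ⊥) :
    Module.finrank K (LinearMap.range (DistribSMul.toLinearMap K M (w₁ * w₂) - 1)) =
      Module.finrank K (LinearMap.range (DistribSMul.toLinearMap K M w₁ - 1)) +
        Module.finrank K (LinearMap.range (DistribSMul.toLinearMap K M w₂ - 1)) := by
  classical
  obtain ⟨l₁, hl₁, -, hprod₁⟩ := exists_pairwise_isOrthogonal_prod_eq_of_mul_self_eq_one b hw₁ h₁
  obtain ⟨l₂, hl₂, -, hprod₂⟩ := exists_pairwise_isOrthogonal_prod_eq_of_mul_self_eq_one b hw₂ h₂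
  have hV₁ := eigenspace_neg_one_eq_span_of_prod_eq hl₁ hprod₁
  have hV₂ := eigenspace_neg_one_eq_span_of_prod_eq hl₂ hprod₂
  have hli₁ := linearIndepOn_root_of_pairwise_isOrthogonal l₁ hl₁
  have hli₂ := linearIndepOn_root_of_pairwise_isOrthogonal l₂ hl₂
  have hdisj : Disjoint (span K (P.root '' {i | i ∈ l₁})) (span K (P.root '' {i | i ∈ l₂})) := by
    rw [← hV₁, ← hV₂, disjoint_iff]
    exact h
  -- the `k₁ + k₂` roots of the concatenated word are distinct and linearly independent
  have hli : LinearIndepOn K P.root {i | i ∈ l₁ ++ l₂} := by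
    have h3 : {i | i ∈ l₁ ++ l₂} = {i | i ∈ l₁} ∪ {i | i ∈ l₂} := by
      ext i
      simp [List.mem_append]
    rw [h3]
    exact hli₁.union hli₂ hdisj
  have hnd : (l₁ ++ l₂).Nodup := by
    rw [List.nodup_append]
    refine ⟨nodup_of_pairwise_isOrthogonal hl₁, nodup_of_pairwise_isOrthogonal hl₂, fun a ha c hc hac ↦ ?_⟩
    subst hac
    have hmem : P.root a ∈ span K (P.root '' {i | i ∈ l₁}) ⊓ span K (P.root '' {i | i ∈ l₂}) :=
      Submodule.mem_inf.mpr ⟨Submodule.subset_span ⟨a, ha, rfl⟩, Submodule.subset_span ⟨a, hc, rfl⟩⟩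
    rw [hdisj.eq_bot, Submodule.mem_bot] at hmem
    exact P.ne_zero a hmem
  -- Carter's Lemma 3 ⟸ (tree): the three words are reduced
  have hk := finrank_range_sub_id_eq_length_of_linearIndependent b (l₁ ++ l₂)
    (linearIndependent_root_getElem_of_linearIndepOn (l₁ ++ l₂) hnd hli)
  have hk₁ := finrank_range_sub_id_eq_length_of_linearIndependent b l₁
    (linearIndependent_root_getElem_of_linearIndepOn l₁ (nodup_of_pairwise_isOrthogonal hl₁) hli₁)
  have hk₂ := finrank_range_sub_id_eq_length_of_linearIndependent b l₂
    (linearIndependent_root_getElem_of_linearIndepOn l₂ (nodup_of_pairwise_isOrthogonal hl₂) hli₂)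
  rw [List.map_append, List.prod_append, hprod₁, hprod₂, List.length_append] at hk
  rw [hprod₁] at hk₁
  rw [hprod₂] at hk₂
  rw [hk, hk₁, hk₂]

include b in
/-- ★★ Carter's form **`dim V_1(w) = dim V_1(w_1) + dim V_1(w_2) - l`** (`l = dim V`; equivalently `l̄(w) = l - dim V_1(w) = 2l - dim V_1(w_1) -
dim V_1(w_2)`), for involutions `w_1, w_2 ∈ W` with `V_{-1}(w_1) ∩ V_{-1}(w_2) = 0`. [cite: Carter1972WeylConjugacy, §3 Lemma 6 (proof: "l̄(w) = l - dim V_1(w) = 2l - dim V_1(w_1) - dim V_1(w_2)")] -/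
theorem finrank_ker_sub_id_mul_of_mul_self_eq_one [Module.Finite K M] {w₁ w₂ : P.Aut} (hw₁ : w₁ ∈ P.weylGroup)
    (hw₂ : w₂ ∈ P.weylGroup) (h₁ : w₁ * w₁ = 1) (h₂ : w₂ * w₂ = 1)
    (h : Module.End.eigenspace (DistribSMul.toLinearMap K M w₁) (-1) ⊓ Module.End.eigenspace (DistribSMul.toLinearMap K M w₂) (-1) = ⊥) :
    Module.finrank K (LinearMap.ker (DistribSMul.toLinearMap K M (w₁ * w₂) - 1)) + Module.finrank K M =
      Module.finrank K (LinearMap.ker (DistribSMul.toLinearMap K M w₁ - 1)) +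
        Module.finrank K (LinearMap.ker (DistribSMul.toLinearMap K M w₂ - 1)) := by
  have h0 := finrank_range_sub_id_mul_eq_add_of_mul_self_eq_one b hw₁ hw₂ h₁ h₂ h
  have e := finrank_range_add_finrank_ker (K := K) (M := M) (w₁ * w₂)
  have e₁ := finrank_range_add_finrank_ker (K := K) (M := M) w₁
  have e₂ := finrank_range_add_finrank_ker (K := K) (M := M) w₂
  omega

include b in
/-- ★ **`l̄(w_1 w_2) = dim V_{-1}(w_1) + dim V_{-1}(w_2)`** (Lemma 6 with `l̄(w_i) = dim V_{-1}(w_i)`, Carter's Lemma 5 count).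
[cite: Carter1972WeylConjugacy, §3 Lemma 6 and §2 Lemma 5] -/
theorem finrank_range_sub_id_mul_eq_add_finrank_eigenspace [Module.Finite K M] {w₁ w₂ : P.Aut} (hw₁ : w₁ ∈ P.weylGroup)
    (hw₂ : w₂ ∈ P.weylGroup) (h₁ : w₁ * w₁ = 1) (h₂ : w₂ * w₂ = 1)
    (h : Module.End.eigenspace (DistribSMul.toLinearMap K M w₁) (-1) ⊓ Module.End.eigenspace (DistribSMul.toLinearMap K M w₂) (-1) = ⊥) :
    Module.finrank K (LinearMap.range (DistribSMul.toLinearMap K M (w₁ * w₂) - 1)) =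
      Module.finrank K (Module.End.eigenspace (DistribSMul.toLinearMap K M w₁) (-1)) +
        Module.finrank K (Module.End.eigenspace (DistribSMul.toLinearMap K M w₂) (-1)) := by
  rw [finrank_range_sub_id_mul_eq_add_of_mul_self_eq_one b hw₁ hw₂ h₁ h₂ h, range_sub_id_eq_eigenspace_neg_one_of_mul_self_eq_one h₁,
    range_sub_id_eq_eigenspace_neg_one_of_mul_self_eq_one h₂]

end Base

omit [CharZero K] [Fintype ι] [P.IsCrystallographic] [P.IsReduced] in
/-- `(w_1 w_2 - 1)V ⊆ (w_1 - 1)V + (w_2 - 1)V` for any `w_1, w_2`: `w_1 w_2 x - x = (w_1 - 1)(w_2 x) + (w_2 - 1)x`.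
[cite: Carter1972WeylConjugacy, §3 Lemma 6 (proof)] -/
theorem range_sub_id_mul_le_sup (w₁ w₂ : P.Aut) :
    LinearMap.range (DistribSMul.toLinearMap K M (w₁ * w₂) - 1) ≤
      LinearMap.range (DistribSMul.toLinearMap K M w₁ - 1) ⊔ LinearMap.range (DistribSMul.toLinearMap K M w₂ - 1) := by
  rintro _ ⟨x, rfl⟩
  have e : (DistribSMul.toLinearMap K M (w₁ * w₂) - 1) x =
      (DistribSMul.toLinearMap K M w₁ - 1) (w₂ • x) + (DistribSMul.toLinearMap K M w₂ - 1) x := by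
    rw [toLinearMap_sub_id_apply (P := P), toLinearMap_sub_id_apply (P := P), toLinearMap_sub_id_apply (P := P), mul_smul]
    abel
  rw [e]
  exact Submodule.add_mem _ (Submodule.mem_sup_left ⟨_, rfl⟩) (Submodule.mem_sup_right ⟨_, rfl⟩)

namespace Base

variable (b : P.Base)

include b in
/-- ★★ **Under the hypotheses of Lemma 6, `(w_1 w_2 - 1)V = V_{-1}(w_1) ⊕ V_{-1}(w_2)`** (the sum is direct by hypothesis; equality by the dimension
count of Lemma 6). [cite: Carter1972WeylConjugacy, §3 Lemma 6 (proof)] -/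
theorem range_sub_id_mul_eq_sup_of_mul_self_eq_one [Module.Finite K M] {w₁ w₂ : P.Aut} (hw₁ : w₁ ∈ P.weylGroup)
    (hw₂ : w₂ ∈ P.weylGroup) (h₁ : w₁ * w₁ = 1) (h₂ : w₂ * w₂ = 1)
    (h : Module.End.eigenspace (DistribSMul.toLinearMap K M w₁) (-1) ⊓ Module.End.eigenspace (DistribSMul.toLinearMap K M w₂) (-1) = ⊥) :
    LinearMap.range (DistribSMul.toLinearMap K M (w₁ * w₂) - 1) =
      Module.End.eigenspace (DistribSMul.toLinearMap K M w₁) (-1) ⊔ Module.End.eigenspace (DistribSMul.toLinearMap K M w₂) (-1) := by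
  rw [← range_sub_id_eq_eigenspace_neg_one_of_mul_self_eq_one h₁, ← range_sub_id_eq_eigenspace_neg_one_of_mul_self_eq_one h₂]
  refine Submodule.eq_of_le_of_finrank_le (range_sub_id_mul_le_sup w₁ w₂) ?_
  rw [finrank_range_sub_id_mul_eq_add_of_mul_self_eq_one b hw₁ hw₂ h₁ h₂ h]
  exact Submodule.finrank_add_le_finrank_add_finrank _ _

end Base

end Length

/-! ## §5 Lemma 7: conjugation -/

section Conjugation

omit [CharZero K] [Fintype ι] [P.IsCrystallographic] [P.IsReduced] in
/-- **`(gwg⁻¹ - 1)V = g · (w - 1)V`.** [cite: Carter1972WeylConjugacy, §3 Lemma 7 (proof: "V_{-1}(w'w_1w'^{-1}) = w'V_{-1}(w_1)")] -/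
theorem range_sub_id_conj_eq_map (g w : P.Aut) :
    LinearMap.range (DistribSMul.toLinearMap K M (g * w * g⁻¹) - 1) =
      (LinearMap.range (DistribSMul.toLinearMap K M w - 1)).map (DistribSMul.toLinearMap K M g) := by
  ext y
  constructor
  · rintro ⟨x, rfl⟩
    refine ⟨w • g⁻¹ • x - g⁻¹ • x, ⟨g⁻¹ • x, rfl⟩, ?_⟩
    rw [DistribSMul.toLinearMap_apply, toLinearMap_sub_id_apply (P := P), smul_sub, smul_inv_smul, mul_smul, mul_smul]
  · rintro ⟨_, ⟨x, rfl⟩, rfl⟩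
    refine ⟨g • x, ?_⟩
    rw [toLinearMap_sub_id_apply (P := P), toLinearMap_sub_id_apply (P := P), DistribSMul.toLinearMap_apply, mul_smul, mul_smul,
      inv_smul_smul, smul_sub]

omit [CharZero K] [Fintype ι] [P.IsCrystallographic] [P.IsReduced] in
/-- ★ **`dim (gwg⁻¹ - 1)V = dim (w - 1)V`**: the reflection length `l̄` is constant on conjugacy classes.
[cite: Carter1972WeylConjugacy, §3 Lemma 7 and the remark after it ("any conjugate of w also has a decomposition with graph Γ")] -/
theorem finrank_range_sub_id_conj (g w : P.Aut) :
    Module.finrank K (LinearMap.range (DistribSMul.toLinearMap K M (g * w * g⁻¹) - 1)) =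
      Module.finrank K (LinearMap.range (DistribSMul.toLinearMap K M w - 1)) := by
  have hinj : Function.Injective (DistribSMul.toLinearMap K M g) := fun x y hxy ↦ MulAction.injective g hxy
  rw [range_sub_id_conj_eq_map]
  exact ((Submodule.equivMapOfInjective _ hinj _).finrank_eq).symm

omit [CharZero K] [Fintype ι] [P.IsCrystallographic] [P.IsReduced] in
/-- **`V_μ(gwg⁻¹) = g · V_μ(w)`** for every eigenvalue `μ`. [cite: Carter1972WeylConjugacy, §3 Lemma 7 (proof: "V_{-1}(w'w_iw'^{-1}) = w'V_{-1}(w_i)")] -/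
theorem eigenspace_conj_eq_map (g w : P.Aut) (μ : K) :
    Module.End.eigenspace (DistribSMul.toLinearMap K M (g * w * g⁻¹)) μ =
      (Module.End.eigenspace (DistribSMul.toLinearMap K M w) μ).map (DistribSMul.toLinearMap K M g) := by
  ext y
  simp only [Module.End.mem_eigenspace_iff, Submodule.mem_map, DistribSMul.toLinearMap_apply, mul_smul]
  constructor
  · intro hy
    refine ⟨g⁻¹ • y, ?_, smul_inv_smul g y⟩
    have h1 := congr_arg (g⁻¹ • ·) hy
    simp only [inv_smul_smul] at h1
    rw [h1, smul_comm g⁻¹ μ y]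
  · rintro ⟨x, hx, rfl⟩
    rw [inv_smul_smul, hx, smul_comm g μ x]

omit [CharZero K] [Fintype ι] [P.IsCrystallographic] [P.IsReduced] in
/-- ★★ **CARTER 1972 §3 LEMMA 7: `W_0` IS A UNION OF CONJUGACY CLASSES OF `W`** — if `w = w_1 w_2` with `w_1, w_2 ∈ W`, `w_1² = w_2² = 1` and
`V_{-1}(w_1) ∩ V_{-1}(w_2) = 0`, then `gwg⁻¹ = (gw_1g⁻¹)(gw_2g⁻¹)` is such a product too (`g ∈ W`; `V_{-1}(gw_ig⁻¹) = g V_{-1}(w_i)`). `W_0` itself is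
not introduced as a definition. [cite: Carter1972WeylConjugacy, §3 Lemma 7 ("W_0 is a union of conjugacy classes of W")] -/
theorem exists_conj_eq_mul_of_eq_mul {w g : P.Aut} (hg : g ∈ P.weylGroup)
    (hw : ∃ w₁ ∈ P.weylGroup, ∃ w₂ ∈ P.weylGroup, w₁ * w₁ = 1 ∧ w₂ * w₂ = 1 ∧
      Module.End.eigenspace (DistribSMul.toLinearMap K M w₁) (-1) ⊓ Module.End.eigenspace (DistribSMul.toLinearMap K M w₂) (-1) = ⊥ ∧
      w = w₁ * w₂) :
    ∃ w₁ ∈ P.weylGroup, ∃ w₂ ∈ P.weylGroup, w₁ * w₁ = 1 ∧ w₂ * w₂ = 1 ∧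
      Module.End.eigenspace (DistribSMul.toLinearMap K M w₁) (-1) ⊓ Module.End.eigenspace (DistribSMul.toLinearMap K M w₂) (-1) = ⊥ ∧
      g * w * g⁻¹ = w₁ * w₂ := by
  obtain ⟨w₁, hw₁, w₂, hw₂, h₁, h₂, h, rfl⟩ := hw
  have hinj : Function.Injective (DistribSMul.toLinearMap K M g) := fun x y hxy ↦ MulAction.injective g hxy
  refine ⟨g * w₁ * g⁻¹, mul_mem (mul_mem hg hw₁) (inv_mem hg), g * w₂ * g⁻¹, mul_mem (mul_mem hg hw₂) (inv_mem hg), ?_, ?_, ?_, ?_⟩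
  · rw [show g * w₁ * g⁻¹ * (g * w₁ * g⁻¹) = g * (w₁ * w₁) * g⁻¹ by group, h₁, mul_one, mul_inv_cancel]
  · rw [show g * w₂ * g⁻¹ * (g * w₂ * g⁻¹) = g * (w₂ * w₂) * g⁻¹ by group, h₂, mul_one, mul_inv_cancel]
  · rw [eigenspace_conj_eq_map, eigenspace_conj_eq_map, ← Submodule.map_inf _ hinj, h, Submodule.map_bot]
  · group

end Conjugation

/-! ## §6 Humphreys §1.14 in geometric form: an element of `W` acting on `V` as a reflection is some `s_α` -/

section GeometricReflection

namespace Base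

variable (b : P.Base)

include b in
/-- `dim (s_α - 1)V = 1`: a reflection of `W` moves exactly a line (`(s_α - 1)V = Kα`). [cite: Humphreys1990, §1.14 Proposition, p. 24 (proof: "s_α cannot fix H pointwise unless H = H_α")] -/
theorem finrank_range_reflection_sub_id [Module.Finite K M] (i : ι) :
    Module.finrank K (LinearMap.range (DistribSMul.toLinearMap K M (RootPairing.Equiv.reflection P i) - 1)) = 1 := by
  have hli : LinearIndependent K (fun j : Fin [i].length ↦ P.root [i][j]) := by
    rw [linearIndependent_root_getElem_iff]
    refine ⟨List.nodup_singleton i, ?_⟩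
    have hs : {j : ι | j ∈ [i]} = {i} := by
      ext j
      simp
    rw [hs]
    exact LinearIndepOn.singleton (P.ne_zero i)
  have h := finrank_range_sub_id_eq_length_of_linearIndependent b [i] hli
  rw [List.map_singleton, List.prod_singleton, List.length_singleton] at h
  exact h

include b in
/-- ★★★ **HUMPHREYS 1990 §1.14 PROPOSITION, GEOMETRIC FORM: «Every reflection in `W` is of the form `s_α` for some `α ∈ Φ`»** — an element
`w ∈ W` acting on `V` as a reflection, i.e. with `dim (w - 1)V = 1` (it fixes a hyperplane pointwise and is `≠ 1`), is `s_α` for some root `α`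
(by Carter's Lemma 2, tree g38-#4: `w` is a product of exactly `dim (w - 1)V = 1` reflections; Humphreys argues through Theorem 1.12 (d)).
[cite: Humphreys1990, §1.14 Proposition, p. 24 ("Every reflection in W is of the form s_α for some α ∈ Φ")] [cite: Carter1972WeylConjugacy, §2 Lemma 2] -/
theorem exists_eq_reflection_of_finrank_range_sub_id_eq_one [Module.Finite K M] {w : P.Aut} (hw : w ∈ P.weylGroup)
    (h : Module.finrank K (LinearMap.range (DistribSMul.toLinearMap K M w - 1)) = 1) :
    ∃ i : ι, w = RootPairing.Equiv.reflection P i := by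
  obtain ⟨l, hl, hprod⟩ := exists_list_length_eq_finrank_range_prod_eq b hw
  rw [h] at hl
  obtain ⟨i, rfl⟩ := List.length_eq_one_iff.mp hl
  exact ⟨i, by rw [← hprod, List.map_singleton, List.prod_singleton]⟩

include b in
/-- ★★ **`w ∈ W` is a reflection `s_α` iff `dim (w - 1)V = 1`.** [cite: Humphreys1990, §1.14 Proposition, p. 24] -/
theorem exists_eq_reflection_iff_finrank_range_sub_id_eq_one [Module.Finite K M] {w : P.Aut} (hw : w ∈ P.weylGroup) :
    (∃ i : ι, w = RootPairing.Equiv.reflection P i) ↔ Module.finrank K (LinearMap.range (DistribSMul.toLinearMap K M w - 1)) = 1 := by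
  refine ⟨?_, exists_eq_reflection_of_finrank_range_sub_id_eq_one b hw⟩
  rintro ⟨i, rfl⟩
  exact finrank_range_reflection_sub_id b i

include b in
/-- ★★ The hyperplane form: **an element of `W` fixing pointwise a subspace of codimension `1` (`dim V^w + 1 = dim V`) is a reflection `s_α`**
(«Let `s` be a reflection in `W`, with reflecting hyperplane `H` fixed pointwise by `s` … `s = s_α`»). [cite: Humphreys1990, §1.14 Proposition, p. 24] -/
theorem exists_eq_reflection_of_finrank_ker_sub_id_add_one_eq [Module.Finite K M] {w : P.Aut} (hw : w ∈ P.weylGroup)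
    (h : Module.finrank K (LinearMap.ker (DistribSMul.toLinearMap K M w - 1)) + 1 = Module.finrank K M) :
    ∃ i : ι, w = RootPairing.Equiv.reflection P i :=
  exists_eq_reflection_of_finrank_range_sub_id_eq_one b hw (by have e := finrank_range_add_finrank_ker (K := K) (M := M) w; omega)

end Base

end GeometricReflection

end Literature.LinearAlgebra.RootSystem
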